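import Literature.IUT.HodgeArakelov.MonoThetaProjective
import HarnessLib

/-!
# [IUTchII] Rmk 1.4.1 (ii): the typed output `PointedInversion E D` is EMPTY as soon as its uniqueness clause fails for ONE
# admissible involution — a proof-only companion (what any «huniq-repair» must overcome)

abc-iut cell, seat abc-iut-L6-d6 (drafted gen 8, filed gen 9), K-L6 row «HUNIQ-REPAIR (R1′) STATEMENT» (L6-lead g8 §F v1.19ds (A6), STATUS
2026-08-27T03:44:01Z; sizing verdict STATUS 04:04:12Z; L6-lead ruling (A1) GO, §F v1.19du 04:08:01Z).  S. Mochizuki, *Inter-universal Teichmüller theory II*, kurims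
manuscript (Dec. 2020), Rmk. 1.4.1 (ii) p. 28 («the unique order two `Δ^tp_{X̲̲_k}`-outer automorphism of `Π^tp_{X̲̲_k}` over
`G_k`»), claim key `Mochizuki2012`, DISPUTED, D-0012 (IUTchII §1 Rmk 1.4.1 (ii), kurims p.28).  PROOF-ONLY: no definition,
no instance, no `Prop`-valued definition, no named fact.

CONTEXT.  abc-iut-L6-t1's FROZEN `structure PointedInversion E D` (`MonoThetaProjective.lean`) — the binder type `I` of
`ThetaEvaluation T E I` ([IUTchII] Cor. 1.12) and of `Prop22_i'` — carries the printed characterisation as the FIELD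
`iota_unique` («every topological automorphism `κ` of `Π` over `G`, of order two modulo `Δ`-inner automorphisms and not
itself `Δ`-inner, is `Δ`-conjugate to `iota`», `Δ := {δ | E.recon.projG (E.isoX δ) = 1}`).  Every model-side Cor. 1.12
display of the cell (the `…Cor112AtModelTate…` lineage) inhabits `I` by abc-iut-w5-d072's `pointedInversionOfPair`, whose
`huniq` argument IS that field verbatim; no proof of the lineage uses it.

WHAT IS PROVED (pure group theory, then one line each).
* §1 `exists_kerConj_trans` — `Δ`-conjugacy relative to `Δ := Ker f` composes: `κ₁ = conj_{δ₁} ∘ ι`, `κ₂ = conj_{δ₂} ∘ ι`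
  (`δᵢ ∈ Δ`) ⟹ `κ₂ = conj_{δ₂δ₁⁻¹} ∘ κ₁`; `not_uniqueOuterOrderTwo_of_two` — if two candidates `κ₁`, `κ₂` (each over `G`, of
  outer order two, not `Δ`-inner) are NOT `Δ`-conjugate, then NO `ι` is «the unique» such automorphism.
* §2 `PointedInversion.isEmpty_of_not_unique` — if ONE `α` over `G`, of outer order two and not `Δ`-inner, is NOT «the
  unique» one (i.e. its uniqueness clause `huniq(α)` fails), then `PointedInversion E D` is EMPTY (for every `D`), hence
  `¬ Rmk141_pointedInversion E D` (`not_rmk141_of_not_unique`); two-candidate form `isEmpty_of_two_outerClasses`.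
  So a REFUTATION of the `huniq` binder of a Cor. 1.12 display at a model (abc-iut-L6-d2, row «HUNIQ-REFUTED-AT-MODEL») is, by
  ONE application, the statement that the binder TYPE `I` is empty there: the display quantifies over an empty slot, and no
  weaker `huniq′` can be substituted by a proof-only re-keying (it would have to inhabit the same field).
HONEST LABEL: a statement about OUR typed interface and OUR models; empty-at-a-model ≠ a statement about print; nothing of
[IUTchII] asserted; no side taken on [IUTchIII] Cor. 3.12; typed ≠ proved; nothing here says abc is proved or refuted.
-/

namespace Literature.IUT.HodgeArakelov

universe u

/-! ### §1. Pure group theory: `Ker f`-conjugacy classes of outer involutions -/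

section Generic

variable {P : Type*} [Group P] {Γ : Type*} [Group Γ] (f : P →* Γ)

/-- `Δ`-conjugacy relative to `Δ := Ker f` composes: if `κ₁ = conj_{δ₁} ∘ ι` and `κ₂ = conj_{δ₂} ∘ ι` with `f δ₁ = f δ₂ = 1`,
then `κ₂ = conj_{δ₂δ₁⁻¹} ∘ κ₁` with `f (δ₂δ₁⁻¹) = 1`. [claim: Mochizuki2012, status: disputed]
(IUTchII §1 Rmk 1.4.1 (ii), kurims p.28) -/
theorem exists_kerConj_trans (ι κ₁ κ₂ : P → P)
    (h₁ : ∃ δ : P, f δ = 1 ∧ ∀ x, κ₁ x = δ * ι x * δ⁻¹) (h₂ : ∃ δ : P, f δ = 1 ∧ ∀ x, κ₂ x = δ * ι x * δ⁻¹) :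
    ∃ δ : P, f δ = 1 ∧ ∀ x, κ₂ x = δ * κ₁ x * δ⁻¹ := by
  obtain ⟨δ₁, hδ₁, h₁⟩ := h₁
  obtain ⟨δ₂, hδ₂, h₂⟩ := h₂
  refine ⟨δ₂ * δ₁⁻¹, by rw [map_mul, map_inv, hδ₁, hδ₂, inv_one, mul_one], fun x => ?_⟩
  rw [h₂, h₁]
  group

/-- **No «unique outer involution» when two non-conjugate candidates exist.**  If `κ₁`, `κ₂` are both over `G` (`f ∘ κᵢ = f`),
of order two modulo `Ker f`-inner automorphisms and not `Ker f`-inner, and `κ₂` is NOT `Ker f`-conjugate to `κ₁`, then no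
`ι : P → P` satisfies the uniqueness clause «every such `κ` is `Ker f`-conjugate to `ι`».
[claim: Mochizuki2012, status: disputed] (IUTchII §1 Rmk 1.4.1 (ii), kurims p.28) -/
theorem not_uniqueOuterOrderTwo_of_two {E : Type*} (ι : P → P) (κ₁ κ₂ : E) (ev : E → P → P)
    (h₁over : ∀ x, f (ev κ₁ x) = f x) (h₁sq : ∃ δ : P, f δ = 1 ∧ ∀ x, ev κ₁ (ev κ₁ x) = δ * x * δ⁻¹)
    (h₁not : ¬ ∃ δ : P, f δ = 1 ∧ ∀ x, ev κ₁ x = δ * x * δ⁻¹)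
    (h₂over : ∀ x, f (ev κ₂ x) = f x) (h₂sq : ∃ δ : P, f δ = 1 ∧ ∀ x, ev κ₂ (ev κ₂ x) = δ * x * δ⁻¹)
    (h₂not : ¬ ∃ δ : P, f δ = 1 ∧ ∀ x, ev κ₂ x = δ * x * δ⁻¹)
    (h12 : ¬ ∃ δ : P, f δ = 1 ∧ ∀ x, ev κ₂ x = δ * ev κ₁ x * δ⁻¹) :
    ¬ ∀ κ : E, (∀ x, f (ev κ x) = f x) → (∃ δ : P, f δ = 1 ∧ ∀ x, ev κ (ev κ x) = δ * x * δ⁻¹) →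
      (¬ ∃ δ : P, f δ = 1 ∧ ∀ x, ev κ x = δ * x * δ⁻¹) → ∃ δ : P, f δ = 1 ∧ ∀ x, ev κ x = δ * ι x * δ⁻¹ :=
  fun huniq => h12 (exists_kerConj_trans f ι (ev κ₁) (ev κ₂) (huniq κ₁ h₁over h₁sq h₁not) (huniq κ₂ h₂over h₂sq h₂not))

end Generic

/-! ### §2. For abc-iut-L6-t1's `PointedInversion E D`: emptiness from the failure of `huniq` for ONE admissible `α` -/

section Interface

variable {S : ThetaSetting.{u}} {P : TopGroup.{u}} {E : EnvOfGroup S P} (D : EtaleThetaData S P)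

/-- **`PointedInversion E D` is EMPTY if two non-`Δ`-conjugate admissible involutions exist** (`Δ := {δ | E.recon.projG
(E.isoX δ) = 1}`; «admissible» = over `G`, of outer order two, not `Δ`-inner): the field `iota_unique` of any inhabitant
would make both `Δ`-conjugate to its `iota`, hence to each other (`exists_kerConj_trans`).
[claim: Mochizuki2012, status: disputed] (IUTchII §1 Rmk 1.4.1 (ii), kurims p.28) -/
theorem PointedInversion.isEmpty_of_two_outerClasses (κ₁ κ₂ : P ≃ₜ* P)
    (h₁over : ∀ x : P, E.recon.projG (E.isoX (κ₁ x)) = E.recon.projG (E.isoX x))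
    (h₁sq : ∃ δ : P, E.recon.projG (E.isoX δ) = 1 ∧ ∀ x : P, κ₁ (κ₁ x) = δ * x * δ⁻¹)
    (h₁not : ¬ ∃ δ : P, E.recon.projG (E.isoX δ) = 1 ∧ ∀ x : P, κ₁ x = δ * x * δ⁻¹)
    (h₂over : ∀ x : P, E.recon.projG (E.isoX (κ₂ x)) = E.recon.projG (E.isoX x))
    (h₂sq : ∃ δ : P, E.recon.projG (E.isoX δ) = 1 ∧ ∀ x : P, κ₂ (κ₂ x) = δ * x * δ⁻¹)
    (h₂not : ¬ ∃ δ : P, E.recon.projG (E.isoX δ) = 1 ∧ ∀ x : P, κ₂ x = δ * x * δ⁻¹)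
    (h12 : ¬ ∃ δ : P, E.recon.projG (E.isoX δ) = 1 ∧ ∀ x : P, κ₂ x = δ * κ₁ x * δ⁻¹) :
    IsEmpty (PointedInversion E D) :=
  ⟨fun I => not_uniqueOuterOrderTwo_of_two (E.recon.projG.comp E.isoX.toMulEquiv.toMonoidHom) I.iota κ₁ κ₂
    (fun κ : P ≃ₜ* P => (κ : P → P)) h₁over h₁sq h₁not h₂over h₂sq h₂not h12 I.iota_unique⟩

/-- **`PointedInversion E D` is EMPTY if the uniqueness clause fails for ONE admissible `α`.**  If `α` is over `G`, of outer
order two and not `Δ`-inner, and `huniq(α)` — «every admissible `κ` is `Δ`-conjugate to `α`», the exact shape of the `huniq`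
argument of abc-iut-w5-d072's `pointedInversionOfPair` / of the field `iota_unique` — FAILS, then there is NO inhabitant at all:
for an inhabitant `I`, `iota_unique` makes `α` and every admissible `κ` `Δ`-conjugate to `I.iota`, hence `κ` `Δ`-conjugate to
`α`. [claim: Mochizuki2012, status: disputed] (IUTchII §1 Rmk 1.4.1 (ii), kurims p.28) -/
theorem PointedInversion.isEmpty_of_not_unique (α : P ≃ₜ* P)
    (hover : ∀ x : P, E.recon.projG (E.isoX (α x)) = E.recon.projG (E.isoX x))
    (hsq : ∃ δ : P, E.recon.projG (E.isoX δ) = 1 ∧ ∀ x : P, α (α x) = δ * x * δ⁻¹)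
    (hnot : ¬ ∃ δ : P, E.recon.projG (E.isoX δ) = 1 ∧ ∀ x : P, α x = δ * x * δ⁻¹)
    (hnu : ¬ ∀ κ : P ≃ₜ* P,
      (∀ x : P, E.recon.projG (E.isoX (κ x)) = E.recon.projG (E.isoX x)) →
      (∃ δ : P, E.recon.projG (E.isoX δ) = 1 ∧ ∀ x : P, κ (κ x) = δ * x * δ⁻¹) →
      (¬ ∃ δ : P, E.recon.projG (E.isoX δ) = 1 ∧ ∀ x : P, κ x = δ * x * δ⁻¹) →
        ∃ δ : P, E.recon.projG (E.isoX δ) = 1 ∧ ∀ x : P, κ x = δ * α x * δ⁻¹) :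
    IsEmpty (PointedInversion E D) :=
  ⟨fun I => hnu fun κ hκover hκsq hκnot =>
    exists_kerConj_trans (E.recon.projG.comp E.isoX.toMulEquiv.toMonoidHom) I.iota α κ
      (I.iota_unique α hover hsq hnot) (I.iota_unique κ hκover hκsq hκnot)⟩

/-- Conversely, an inhabitant `I` makes EVERY admissible `α` «the unique» one: `huniq(α)` holds (so `huniq` is consistent
exactly when `PointedInversion E D` is inhabited — the clause is all-or-nothing across admissible `α`).
[claim: Mochizuki2012, status: disputed] (IUTchII §1 Rmk 1.4.1 (ii), kurims p.28) -/
theorem PointedInversion.unique_of_pointedInversion (I : PointedInversion E D) (α : P ≃ₜ* P)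
    (hover : ∀ x : P, E.recon.projG (E.isoX (α x)) = E.recon.projG (E.isoX x))
    (hsq : ∃ δ : P, E.recon.projG (E.isoX δ) = 1 ∧ ∀ x : P, α (α x) = δ * x * δ⁻¹)
    (hnot : ¬ ∃ δ : P, E.recon.projG (E.isoX δ) = 1 ∧ ∀ x : P, α x = δ * x * δ⁻¹) (κ : P ≃ₜ* P)
    (hκover : ∀ x : P, E.recon.projG (E.isoX (κ x)) = E.recon.projG (E.isoX x))
    (hκsq : ∃ δ : P, E.recon.projG (E.isoX δ) = 1 ∧ ∀ x : P, κ (κ x) = δ * x * δ⁻¹)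
    (hκnot : ¬ ∃ δ : P, E.recon.projG (E.isoX δ) = 1 ∧ ∀ x : P, κ x = δ * x * δ⁻¹) :
    ∃ δ : P, E.recon.projG (E.isoX δ) = 1 ∧ ∀ x : P, κ x = δ * α x * δ⁻¹ :=
  exists_kerConj_trans (E.recon.projG.comp E.isoX.toMulEquiv.toMonoidHom) I.iota α κ
    (I.iota_unique α hover hsq hnot) (I.iota_unique κ hκover hκsq hκnot)

/-- **The typed existence clause `Rmk141_pointedInversion E D` FAILS if `huniq(α)` fails for one admissible `α`.**
[claim: Mochizuki2012, status: disputed] (IUTchII §1 Rmk 1.4.1 (ii), kurims p.28) -/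
theorem not_rmk141_of_not_unique (α : P ≃ₜ* P)
    (hover : ∀ x : P, E.recon.projG (E.isoX (α x)) = E.recon.projG (E.isoX x))
    (hsq : ∃ δ : P, E.recon.projG (E.isoX δ) = 1 ∧ ∀ x : P, α (α x) = δ * x * δ⁻¹)
    (hnot : ¬ ∃ δ : P, E.recon.projG (E.isoX δ) = 1 ∧ ∀ x : P, α x = δ * x * δ⁻¹)
    (hnu : ¬ ∀ κ : P ≃ₜ* P,
      (∀ x : P, E.recon.projG (E.isoX (κ x)) = E.recon.projG (E.isoX x)) →
      (∃ δ : P, E.recon.projG (E.isoX δ) = 1 ∧ ∀ x : P, κ (κ x) = δ * x * δ⁻¹) →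
      (¬ ∃ δ : P, E.recon.projG (E.isoX δ) = 1 ∧ ∀ x : P, κ x = δ * x * δ⁻¹) →
        ∃ δ : P, E.recon.projG (E.isoX δ) = 1 ∧ ∀ x : P, κ x = δ * α x * δ⁻¹) :
    ¬ Rmk141_pointedInversion E D := by
  rw [Rmk141_pointedInversion, not_nonempty_iff]
  exact PointedInversion.isEmpty_of_not_unique D α hover hsq hnot hnu

/-- Two-candidate form of the same refutation of `Rmk141_pointedInversion E D`.
[claim: Mochizuki2012, status: disputed] (IUTchII §1 Rmk 1.4.1 (ii), kurims p.28) -/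
theorem not_rmk141_of_two_outerClasses (κ₁ κ₂ : P ≃ₜ* P)
    (h₁over : ∀ x : P, E.recon.projG (E.isoX (κ₁ x)) = E.recon.projG (E.isoX x))
    (h₁sq : ∃ δ : P, E.recon.projG (E.isoX δ) = 1 ∧ ∀ x : P, κ₁ (κ₁ x) = δ * x * δ⁻¹)
    (h₁not : ¬ ∃ δ : P, E.recon.projG (E.isoX δ) = 1 ∧ ∀ x : P, κ₁ x = δ * x * δ⁻¹)
    (h₂over : ∀ x : P, E.recon.projG (E.isoX (κ₂ x)) = E.recon.projG (E.isoX x))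
    (h₂sq : ∃ δ : P, E.recon.projG (E.isoX δ) = 1 ∧ ∀ x : P, κ₂ (κ₂ x) = δ * x * δ⁻¹)
    (h₂not : ¬ ∃ δ : P, E.recon.projG (E.isoX δ) = 1 ∧ ∀ x : P, κ₂ x = δ * x * δ⁻¹)
    (h12 : ¬ ∃ δ : P, E.recon.projG (E.isoX δ) = 1 ∧ ∀ x : P, κ₂ x = δ * κ₁ x * δ⁻¹) :
    ¬ Rmk141_pointedInversion E D := by
  rw [Rmk141_pointedInversion, not_nonempty_iff]
  exact PointedInversion.isEmpty_of_two_outerClasses D κ₁ κ₂ h₁over h₁sq h₁not h₂over h₂sq h₂not h12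

end Interface

end Literature.IUT.HodgeArakelov
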